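import Summits.AtomisticToContinuum.HydrodynamicLimit.Theorems.OneFlightGossipEngineClampedCurrentsDockHeartPathwise
import Summits.AtomisticToContinuum.HydrodynamicLimit.Theorems.OneFlightGossipEngineClampedCurrentsDockCancellation
import Summits.AtomisticToContinuum.HydrodynamicLimit.Theorems.OneFlightGossipEngineClampedCurrentsDockFreezeToolkit
import HarnessLib

/-!
# The heart of Yau's entropy ledger — the frozen pathwise bookkeeping along an Euler solution (crux `ClampedCurrentsDock`, stmt-14680, line `IdeatorTwoSketch`)

Helper file (`--supports stmt-AtomisticToContinuum-14680`) for the registered stub `stub_oneWindowLedger`: the abstract one-window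
bookkeeping `heart_pathwise` instantiated along a classical hs-Euler solution — Euler cancellation S8 pointwise (landed), the split
`fast = lo + hi` of the fast kinetic currents at the window start, time-freezing of the streaming integrands and of the collision
kernel by the freeze bounds FZ (constant `C_f`), interval-integrability of the streaming rate along good orbits.
prover-line-stmt-AtomisticToContinuum-14680-c2-0 (lead c2).
-/

noncomputable section

namespace Summit.AtomisticToContinuum.HydrodynamicLimit.Theorems.ClampedCurrentsDockHeart

open scoped BigOperators ENNReal Classical Interval
open MeasureTheory Filter Set Topology InformationTheory
open Literature.MathematicalPhysics.KineticTheory Literature.Analysis.FluidPDE Literature.Analysis.FunctionSpaces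
open Summit.AtomisticToContinuum.HydrodynamicLimit.Theorems

/-- The window `[s, s+w]` of a ledger step lies in the slab `[0, t]` (`0 ≤ s`, `s + w ≤ t`). [folklore] -/
theorem window_Icc_subset_slab {s w t : ℝ} (hs0 : 0 ≤ s) (hsw : s + w ≤ t) : Set.Icc s (s + w) ⊆ Set.Icc 0 t :=
  fun _ hr => ⟨hs0.trans hr.1, hr.2.trans hsw⟩

/-- **THE FROZEN PATHWISE BOOKKEEPING OF ONE WINDOW along a classical hs-Euler solution** (see the file header): on a good orbit,
`−(Str + Col) ≤ −∫Σ lo_s + |∫Σ hi_s| + (∫Σ P_s − Σ_coll K_s) + C_f w ∫Σ(3 + 2‖v‖³) + 2 C_f w ε_N Σ_i A_i`. [cite: Yau1991, §3] -/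
theorem window_pathwise {σ T η₁ t s w Cfz : ℝ} {N : ℕ}
    (Φ : HardSphereFlow (Torus.geometry (Fin 3)) (hsDiameter σ N) (N + 1))
    {ρ θ : ℝ → T3 → ℝ} {u : ℝ → T3 → V3} {F Rf : ℝ → ℝ} {G : ℝ → T3 × ℝ → ℝ}
    (hEul : IsHardSphereEulerSolution σ T ρ u θ) (hσ : 0 < σ) (hσ2 : σ < 1 / 2) (hη₁ : 0 < η₁)
    (hF : AnalyticOnNhd ℝ F (Ioo (-η₁) η₁)) (hZF : ∀ η ∈ Ioo 0 η₁, hsCompressibility η = 1 + η * deriv F η)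
    (hRfF : ∀ η ∈ Ioo 0 η₁, 0 < Rf η ∧ DifferentiableAt ℝ (fun x => Real.log (Rf x)) η ∧
      deriv (fun x => Real.log (Rf x)) η = 2 * deriv F η + η * deriv (deriv F) η)
    (hpackF : ∀ t' ∈ Ico 0 T, ∀ x, ρ t' x * σ ^ 3 ∈ Ioo 0 η₁)
    (ha : Torus.IsSmoothSpaceTimeOn (Ico 0 T) fun t' x => ρ t' x * Rf (σ ^ 3 * ρ t' x))
    (ha0 : ∀ t' ∈ Ico 0 T, ∀ x, 0 < ρ t' x * Rf (σ ^ 3 * ρ t' x))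
    (ht : t ∈ Ioo 0 T) (hs0 : 0 ≤ s) (hw : 0 < w) (hsw : s + w ≤ t) (hCfz0 : 0 ≤ Cfz) (hGs : Continuous (G s))
    (HFZ : ∀ s₁ ∈ Icc 0 t, ∀ s₂ ∈ Icc 0 t, ∀ (x : T3) (v : V3),
      (let fast := fun (s : ℝ) (y : T3 × V3) =>
         (θ s y.1)⁻¹ * ∑ j : Fin 3, ∑ k : Fin 3,
             ((y.2 - u s y.1) j * (y.2 - u s y.1) k - (if j = k then ‖y.2 - u s y.1‖ ^ 2 / 3 else 0)) *
               Torus.partialDeriv k (fun x => u s x j) y.1 +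
           (‖y.2 - u s y.1‖ ^ 2 - 5 * θ s y.1) * (∑ k : Fin 3, (y.2 - u s y.1) k * Torus.partialDeriv k (θ s) y.1) /
             (2 * (θ s y.1) ^ 2)
       let P := fun (s : ℝ) (y : T3 × V3) =>
         (∑ k : Fin 3, Torus.partialDeriv k (fun x => u s x k / θ s x) y.1) *
           (θ s y.1 * (ρ s y.1 * σ ^ 3) * deriv hsCompressibility (ρ s y.1 * σ ^ 3) +
             (1 / 3) * (hsCompressibility (ρ s y.1 * σ ^ 3) - 1) * ‖y.2 - u s y.1‖ ^ 2) +
         ((∑ k : Fin 3, u s y.1 k * Torus.partialDeriv k (θ s) y.1) / (θ s y.1) ^ 2) *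
           (θ s y.1 * (ρ s y.1 * σ ^ 3) * deriv hsCompressibility (ρ s y.1 * σ ^ 3) +
             (1 / 3) * (hsCompressibility (ρ s y.1 * σ ^ 3) - 1) * ‖y.2 - u s y.1‖ ^ 2) +
         (hsCompressibility (ρ s y.1 * σ ^ 3) - 1) *
           (∑ k : Fin 3, (y.2 - u s y.1) k * Torus.partialDeriv k (θ s) y.1) / θ s y.1
       |fast s₁ (x, v) - fast s₂ (x, v)| ≤ Cfz * |s₁ - s₂| * (1 + ‖v‖ ^ 3) ∧
       |P s₁ (x, v) - P s₂ (x, v)| ≤ Cfz * |s₁ - s₂| * (1 + ‖v‖ ^ 2) ∧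
       (∀ (k : Fin 3) (x' : T3),
          |(u s₁ x k / θ s₁ x - u s₁ x' k / θ s₁ x') - (u s₂ x k / θ s₂ x - u s₂ x' k / θ s₂ x')| ≤
            Cfz * |s₁ - s₂| * Torus.euclidDist x x') ∧
       (∀ x' : T3, |((θ s₁ x)⁻¹ - (θ s₁ x')⁻¹) - ((θ s₂ x)⁻¹ - (θ s₂ x')⁻¹)| ≤ Cfz * |s₁ - s₂| * Torus.euclidDist x x') ∧
       (∀ (k : Fin 3) (x' : T3), |u s₁ x k / θ s₁ x - u s₁ x' k / θ s₁ x'| ≤ Cfz * Torus.euclidDist x x') ∧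
       (∀ x' : T3, |(-(θ s₁ x)⁻¹) - (-(θ s₁ x')⁻¹)| ≤ Cfz * Torus.euclidDist x x')))
    {z : Config (N + 1) (Fin 3) T3} (hz : z ∈ Φ.good) :
    -((∫ r' in s..(s + w), ∑ i : Fin (N + 1),
        (Torus.timeDerivWithin (Ico 0 T) (fun t'' x =>
            Real.log (ρ t'' x * Rf (σ ^ 3 * ρ t'' x)) - 3 / 2 * Real.log (2 * Real.pi * θ t'' x) -
              ‖(Φ.flow r' z i).2 - u t'' x‖ ^ 2 / (2 * θ t'' x)) r' (Φ.flow r' z i).1 +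
          ∑ k : Fin 3, (Φ.flow r' z i).2 k * Torus.partialDeriv k (fun x =>
            Real.log (ρ r' x * Rf (σ ^ 3 * ρ r' x)) - 3 / 2 * Real.log (2 * Real.pi * θ r' x) -
              ‖(Φ.flow r' z i).2 - u r' x‖ ^ 2 / (2 * θ r' x)) (Φ.flow r' z i).1)) +
      Φ.collisionSum (Ioc s (s + w)) (fun c =>
        ((∑ k : Fin 3, (u c.time c.fstPos k / θ c.time c.fstPos - u c.time c.sndPos k / θ c.time c.sndPos) *
            (c.postVel.1 k - c.preVel.1 k)) -
          ((θ c.time c.fstPos)⁻¹ - (θ c.time c.sndPos)⁻¹) * ((‖c.postVel.1‖ ^ 2 - ‖c.preVel.1‖ ^ 2) / 2)) / 2) z) ≤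
    -(∫ r' in s..(s + w), ∑ i : Fin (N + 1),
        ((θ s (Φ.flow r' z i).1)⁻¹ * ∑ j : Fin 3, ∑ k : Fin 3,
            (((Φ.flow r' z i).2 - u s (Φ.flow r' z i).1) j * ((Φ.flow r' z i).2 - u s (Φ.flow r' z i).1) k -
              (if j = k then ‖(Φ.flow r' z i).2 - u s (Φ.flow r' z i).1‖ ^ 2 / 3 else 0)) *
              Torus.partialDeriv k (fun x => u s x j) (Φ.flow r' z i).1 +
          (∑ k : Fin 3, Torus.partialDeriv k (θ s) (Φ.flow r' z i).1 / (2 * (θ s (Φ.flow r' z i).1) ^ 2) *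
            ((Φ.flow r' z i).2 - u s (Φ.flow r' z i).1) k) *
            G s ((Φ.flow r' z i).1, ‖(Φ.flow r' z i).2 - u s (Φ.flow r' z i).1‖ ^ 2))) +
    |∫ r' in s..(s + w), ∑ i : Fin (N + 1),
        (∑ k : Fin 3, Torus.partialDeriv k (θ s) (Φ.flow r' z i).1 / (2 * (θ s (Φ.flow r' z i).1) ^ 2) *
            ((Φ.flow r' z i).2 - u s (Φ.flow r' z i).1) k) *
          (‖(Φ.flow r' z i).2 - u s (Φ.flow r' z i).1‖ ^ 2 - 5 * θ s (Φ.flow r' z i).1 -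
            G s ((Φ.flow r' z i).1, ‖(Φ.flow r' z i).2 - u s (Φ.flow r' z i).1‖ ^ 2))| +
    ((∫ r' in s..(s + w), ∑ i : Fin (N + 1),
        ((∑ k : Fin 3, Torus.partialDeriv k (fun x => u s x k / θ s x) (Φ.flow r' z i).1) *
            (θ s (Φ.flow r' z i).1 * (ρ s (Φ.flow r' z i).1 * σ ^ 3) * deriv hsCompressibility (ρ s (Φ.flow r' z i).1 * σ ^ 3) +
              (1 / 3) * (hsCompressibility (ρ s (Φ.flow r' z i).1 * σ ^ 3) - 1) * ‖(Φ.flow r' z i).2 - u s (Φ.flow r' z i).1‖ ^ 2) +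
          ((∑ k : Fin 3, u s (Φ.flow r' z i).1 k * Torus.partialDeriv k (θ s) (Φ.flow r' z i).1) / (θ s (Φ.flow r' z i).1) ^ 2) *
            (θ s (Φ.flow r' z i).1 * (ρ s (Φ.flow r' z i).1 * σ ^ 3) * deriv hsCompressibility (ρ s (Φ.flow r' z i).1 * σ ^ 3) +
              (1 / 3) * (hsCompressibility (ρ s (Φ.flow r' z i).1 * σ ^ 3) - 1) * ‖(Φ.flow r' z i).2 - u s (Φ.flow r' z i).1‖ ^ 2) +
          (hsCompressibility (ρ s (Φ.flow r' z i).1 * σ ^ 3) - 1) *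
            (∑ k : Fin 3, ((Φ.flow r' z i).2 - u s (Φ.flow r' z i).1) k * Torus.partialDeriv k (θ s) (Φ.flow r' z i).1) / θ s (Φ.flow r' z i).1)) -
      Φ.collisionSum (Ioc s (s + w)) (fun c =>
        ((∑ k : Fin 3, (u s c.fstPos k / θ s c.fstPos - u s c.sndPos k / θ s c.sndPos) * (c.postVel.1 k - c.preVel.1 k)) -
          ((θ s c.fstPos)⁻¹ - (θ s c.sndPos)⁻¹) * ((‖c.postVel.1‖ ^ 2 - ‖c.preVel.1‖ ^ 2) / 2)) / 2) z) +
    Cfz * w * (∫ r' in s..(s + w), ∑ i : Fin (N + 1), (3 + 2 * ‖(Φ.flow r' z i).2‖ ^ 3)) +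
    2 * (Cfz * w * hsDiameter σ N) * (∑ i : Fin (N + 1), Φ.collisionSum (Ioc s (s + w)) (fun c => if c.fst = i then
        ‖c.postVel.1 - c.preVel.1‖ + |‖c.postVel.1‖ ^ 2 - ‖c.preVel.1‖ ^ 2| / 2 else 0) z) := by
  have hsw' : s ≤ s + w := le_add_of_nonneg_right hw.le
  have hsT : s ∈ Set.Ico 0 T := ⟨hs0, (hsw'.trans hsw).trans_lt ht.2⟩
  have hs_t : s ∈ Set.Icc 0 t := ⟨hs0, hsw'.trans hsw⟩
  have hIcc_t : Set.Icc s (s + w) ⊆ Set.Icc 0 t := window_Icc_subset_slab hs0 hsw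
  have hsw_T : s + w < T := hsw.trans_lt ht.2
  have hS8 := ClampedCurrentsDockCancellation.stub_cancellation σ T η₁ ρ θ u F Rf hEul hσ hη₁ hF hZF hRfF hpackF
  -- slices at the window start
  have hθs : Torus.IsSmooth (θ s) := hEul.smooth_temperature.isSmooth_slice hsT
  have hus : Torus.IsSmooth (u s) := hEul.smooth_velocity.isSmooth_slice hsT
  have hρs : Torus.IsSmooth (ρ s) := hEul.smooth_density.isSmooth_slice hsT
  have hθsc : Continuous (θ s) := hθs.continuous
  have husc : Continuous (u s) := hus.continuous
  have hρsc : Continuous (ρ s) := hρs.continuous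
  have hθs0 : ∀ x, 0 < θ s x := hEul.temperature_pos s hsT
  obtain ⟨hZst, hZ'st⟩ := ClampedCurrentsDockFreezeToolkit.sst_hsCompressibility_comp (S := Set.Ico 0 T) hF hZF
    hEul.smooth_density hpackF
  have hZc : Continuous fun x => hsCompressibility (ρ s x * σ ^ 3) := (hZst.isSmooth_slice hsT).continuous
  have hZ'c : Continuous fun x => deriv hsCompressibility (ρ s x * σ ^ 3) := (hZ'st.isSmooth_slice hsT).continuous
  have hpdθ : ∀ k, Continuous (Torus.partialDeriv k (θ s)) := fun k => (hθs.partialDeriv k).continuous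
  have hpdu : ∀ k j, Continuous (Torus.partialDeriv k (fun x => u s x j)) := fun k j =>
    ((hus.apply j).partialDeriv k).continuous
  have hφms : ∀ k, Torus.IsSmooth (fun x => u s x k / θ s x) := fun k => (hus.apply k).div hθs fun _ => (hθs0 _).ne'
  have hφes : Torus.IsSmooth (fun x => -(θ s x)⁻¹) := (hθs.inv fun _ => (hθs0 _).ne').neg
  have hpdm : ∀ k, Continuous (Torus.partialDeriv k (fun x => u s x k / θ s x)) := fun k =>
    ((hφms k).partialDeriv k).continuous
  have hpde : ∀ l, Continuous (Torus.partialDeriv l (fun x => -(θ s x)⁻¹)) := fun l =>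
    (hφes.partialDeriv l).continuous
  -- abstract coefficient functions (for `fun_prop`)
  set Zf : T3 → ℝ := fun x => hsCompressibility (ρ s x * σ ^ 3) with hZf
  set Z'f : T3 → ℝ := fun x => deriv hsCompressibility (ρ s x * σ ^ 3) with hZ'f
  set Dm : Fin 3 → T3 → ℝ := fun k => Torus.partialDeriv k (fun x => u s x k / θ s x) with hDm
  set Dθ : Fin 3 → T3 → ℝ := fun k => Torus.partialDeriv k (θ s) with hDθ
  set Du : Fin 3 → Fin 3 → T3 → ℝ := fun k j => Torus.partialDeriv k (fun x => u s x j) with hDu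
  have hDmc : ∀ k, Continuous (Dm k) := hpdm
  have hDθc : ∀ k, Continuous (Dθ k) := hpdθ
  have hDuc : ∀ k j, Continuous (Du k j) := hpdu
  -- the frozen kinetic functionals at the window start
  set loF : T3 × V3 → ℝ := fun y =>
    (θ s y.1)⁻¹ * ∑ j : Fin 3, ∑ k : Fin 3,
        ((y.2 - u s y.1) j * (y.2 - u s y.1) k - (if j = k then ‖y.2 - u s y.1‖ ^ 2 / 3 else 0)) *
          Torus.partialDeriv k (fun x => u s x j) y.1 +
      (∑ k : Fin 3, Torus.partialDeriv k (θ s) y.1 / (2 * (θ s y.1) ^ 2) * (y.2 - u s y.1) k) *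
        G s (y.1, ‖y.2 - u s y.1‖ ^ 2) with hloF
  set hiF : T3 × V3 → ℝ := fun y =>
    (∑ k : Fin 3, Torus.partialDeriv k (θ s) y.1 / (2 * (θ s y.1) ^ 2) * (y.2 - u s y.1) k) *
      (‖y.2 - u s y.1‖ ^ 2 - 5 * θ s y.1 - G s (y.1, ‖y.2 - u s y.1‖ ^ 2)) with hhiF
  -- FZ's families (verbatim)
  set fastF : ℝ → T3 × V3 → ℝ := fun (s : ℝ) (y : T3 × V3) =>
    (θ s y.1)⁻¹ * ∑ j : Fin 3, ∑ k : Fin 3,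
        ((y.2 - u s y.1) j * (y.2 - u s y.1) k - (if j = k then ‖y.2 - u s y.1‖ ^ 2 / 3 else 0)) *
          Torus.partialDeriv k (fun x => u s x j) y.1 +
      (‖y.2 - u s y.1‖ ^ 2 - 5 * θ s y.1) * (∑ k : Fin 3, (y.2 - u s y.1) k * Torus.partialDeriv k (θ s) y.1) /
        (2 * (θ s y.1) ^ 2) with hfastF
  set PF : ℝ → T3 × V3 → ℝ := fun (s : ℝ) (y : T3 × V3) =>
    (∑ k : Fin 3, Torus.partialDeriv k (fun x => u s x k / θ s x) y.1) *
        (θ s y.1 * (ρ s y.1 * σ ^ 3) * deriv hsCompressibility (ρ s y.1 * σ ^ 3) +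
          (1 / 3) * (hsCompressibility (ρ s y.1 * σ ^ 3) - 1) * ‖y.2 - u s y.1‖ ^ 2) +
      ((∑ k : Fin 3, u s y.1 k * Torus.partialDeriv k (θ s) y.1) / (θ s y.1) ^ 2) *
        (θ s y.1 * (ρ s y.1 * σ ^ 3) * deriv hsCompressibility (ρ s y.1 * σ ^ 3) +
          (1 / 3) * (hsCompressibility (ρ s y.1 * σ ^ 3) - 1) * ‖y.2 - u s y.1‖ ^ 2) +
      (hsCompressibility (ρ s y.1 * σ ^ 3) - 1) *
        (∑ k : Fin 3, (y.2 - u s y.1) k * Torus.partialDeriv k (θ s) y.1) / θ s y.1 with hPF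
  -- C0's streaming integrand (verbatim) and collision kernel; the kernel frozen at the window start
  set DgF : ℝ → T3 × V3 → ℝ := fun (t' : ℝ) (y : T3 × V3) =>
    Torus.timeDerivWithin (Set.Ico 0 T) (fun t'' x => (fun (t : ℝ) (y : T3 × V3) =>
      Real.log (ρ t y.1 * Rf (σ ^ 3 * ρ t y.1)) - 3 / 2 * Real.log (2 * Real.pi * θ t y.1) - ‖y.2 - u t y.1‖ ^ 2 / (2 * θ t y.1)) t'' (x, y.2)) t' y.1 +
    ∑ k : Fin 3, y.2 k * Torus.partialDeriv k (fun x => (fun (t : ℝ) (y : T3 × V3) =>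
      Real.log (ρ t y.1 * Rf (σ ^ 3 * ρ t y.1)) - 3 / 2 * Real.log (2 * Real.pi * θ t y.1) - ‖y.2 - u t y.1‖ ^ 2 / (2 * θ t y.1)) t' (x, y.2)) y.1
    with hDgF
  set Kt : HardSphereCollisionRecord (Fin 3) T3 (N + 1) → ℝ := fun c =>
    ((∑ k : Fin 3, (u c.time c.fstPos k / θ c.time c.fstPos - u c.time c.sndPos k / θ c.time c.sndPos) *
        (c.postVel.1 k - c.preVel.1 k)) -
      ((θ c.time c.fstPos)⁻¹ - (θ c.time c.sndPos)⁻¹) * ((‖c.postVel.1‖ ^ 2 - ‖c.preVel.1‖ ^ 2) / 2)) / 2 with hKt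
  set Ksf : HardSphereCollisionRecord (Fin 3) T3 (N + 1) → ℝ := fun c =>
    ((∑ k : Fin 3, (u s c.fstPos k / θ s c.fstPos - u s c.sndPos k / θ s c.sndPos) * (c.postVel.1 k - c.preVel.1 k)) -
      ((θ s c.fstPos)⁻¹ - (θ s c.sndPos)⁻¹) * ((‖c.postVel.1‖ ^ 2 - ‖c.preVel.1‖ ^ 2) / 2)) / 2 with hKsf
  have hεN : 0 < hsDiameter σ N := hsDiameter_pos hσ N
  -- ===== the pathwise bookkeeping on the good set =====
  have hDP : ∀ r ∈ Set.Icc s (s + w), ∀ y : T3 × V3, DgF r y = fastF r y - PF r y := by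
    intro r hr y
    have h := hS8 r ⟨hs0.trans hr.1, (hr.2.trans hsw).trans_lt ht.2⟩ y.1 y.2
    dsimp only at h
    simp only [hDgF, hfastF, hPF]
    linarith [h]
  have hlohi : ∀ y, fastF s y = loF y + hiF y := by
    intro y
    simp only [hfastF, hloF, hhiF]
    have e : ∑ k : Fin 3, Torus.partialDeriv k (θ s) y.1 / (2 * (θ s y.1) ^ 2) * (y.2 - u s y.1) k =
        (∑ k : Fin 3, (y.2 - u s y.1) k * Torus.partialDeriv k (θ s) y.1) / (2 * (θ s y.1) ^ 2) := by
      rw [Finset.sum_div]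
      exact Finset.sum_congr rfl fun k _ => by ring
    rw [e]
    ring
  have hθne : ∀ y : T3 × V3, θ s y.1 ≠ 0 := fun y => (hθs0 _).ne'
  have hPc : Continuous (PF s) := by
    show Continuous fun y : T3 × V3 =>
      (∑ k : Fin 3, Dm k y.1) * (θ s y.1 * (ρ s y.1 * σ ^ 3) * Z'f y.1 + (1 / 3) * (Zf y.1 - 1) * ‖y.2 - u s y.1‖ ^ 2) +
      ((∑ k : Fin 3, u s y.1 k * Dθ k y.1) / (θ s y.1) ^ 2) *
        (θ s y.1 * (ρ s y.1 * σ ^ 3) * Z'f y.1 + (1 / 3) * (Zf y.1 - 1) * ‖y.2 - u s y.1‖ ^ 2) +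
      (Zf y.1 - 1) * (∑ k : Fin 3, (y.2 - u s y.1) k * Dθ k y.1) / θ s y.1
    fun_prop (disch := (intro y; first | exact hθne y | exact pow_ne_zero _ (hθne y)))
  have hloc : Continuous loF := by
    have h1 : Continuous fun y : T3 × V3 => (θ s y.1)⁻¹ := by
      fun_prop (disch := (intro y; exact hθne y))
    have h2 : Continuous fun y : T3 × V3 => ∑ j : Fin 3, ∑ k : Fin 3,
        ((y.2 - u s y.1) j * (y.2 - u s y.1) k - (if j = k then ‖y.2 - u s y.1‖ ^ 2 / 3 else 0)) * Du k j y.1 := by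
      refine continuous_finsetSum _ fun j _ => continuous_finsetSum _ fun k _ => ?_
      by_cases h : j = k
      · simp only [if_pos h]; fun_prop
      · simp only [if_neg h]; fun_prop
    have h3 : Continuous fun y : T3 × V3 =>
        (∑ k : Fin 3, Dθ k y.1 / (2 * (θ s y.1) ^ 2) * (y.2 - u s y.1) k) * G s (y.1, ‖y.2 - u s y.1‖ ^ 2) := by
      fun_prop (disch := (intro y; exact mul_ne_zero two_ne_zero (pow_ne_zero _ (hθne y))))
    exact (h1.mul h2).add h3
  have hhic : Continuous hiF := by
    show Continuous fun y : T3 × V3 =>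
      (∑ k : Fin 3, Dθ k y.1 / (2 * (θ s y.1) ^ 2) * (y.2 - u s y.1) k) *
        (‖y.2 - u s y.1‖ ^ 2 - 5 * θ s y.1 - G s (y.1, ‖y.2 - u s y.1‖ ^ 2))
    fun_prop (disch := (intro y; exact mul_ne_zero two_ne_zero (pow_ne_zero _ (hθne y))))
  have hfz1 : ∀ r ∈ Set.Icc s (s + w), ∀ y : T3 × V3, |fastF r y - fastF s y| ≤ Cfz * |r - s| * (1 + ‖y.2‖ ^ 3) :=
    fun r hr y => (HFZ r (hIcc_t hr) s hs_t y.1 y.2).1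
  have hfz2 : ∀ r ∈ Set.Icc s (s + w), ∀ y : T3 × V3, |PF r y - PF s y| ≤ Cfz * |r - s| * (1 + ‖y.2‖ ^ 2) :=
    fun r hr y => (HFZ r (hIcc_t hr) s hs_t y.1 y.2).2.1
  have hDgI : ∀ z ∈ Φ.good, IntervalIntegrable (fun r => ∑ i, DgF r (Φ.flow r z i)) volume s (s + w) := by
    intro z hz
    have h := ClampedCurrentsDockHeart.intervalIntegrable_DgSum Φ ha hEul.smooth_temperature
      hEul.smooth_velocity ha0 hEul.temperature_pos hz hs0 hw.le hsw_T
    simpa only [ClampedCurrentsDockPathwise.DgSum, ClampedCurrentsDockPathwise.DgExp,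
      ClampedCurrentsDockPathwise.gExp] using h
  have hKfz : ∀ z ∈ Φ.good, ∀ t' ∈ collisionTimes (Torus.geometry (Fin 3)) (hsDiameter σ N)
      (fun t => Φ.flow t z) ∩ Set.Ioc s (s + w),
      ∀ p ∈ contactPairs (Torus.geometry (Fin 3)) (hsDiameter σ N) (Φ.flow t' z),
      |Kt (HardSphereCollisionRecord.ofConfig (Torus.geometry (Fin 3)) (hsDiameter σ N) (Φ.flow t' z) t' p.1 p.2) -
          Ksf (HardSphereCollisionRecord.ofConfig (Torus.geometry (Fin 3)) (hsDiameter σ N) (Φ.flow t' z) t' p.1 p.2)| ≤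
        (Cfz * w * hsDiameter σ N) *
          (‖(HardSphereCollisionRecord.ofConfig (Torus.geometry (Fin 3)) (hsDiameter σ N)
                (Φ.flow t' z) t' p.1 p.2).postVel.1 -
              (HardSphereCollisionRecord.ofConfig (Torus.geometry (Fin 3)) (hsDiameter σ N)
                (Φ.flow t' z) t' p.1 p.2).preVel.1‖ +
          |‖(HardSphereCollisionRecord.ofConfig (Torus.geometry (Fin 3)) (hsDiameter σ N)
                (Φ.flow t' z) t' p.1 p.2).postVel.1‖ ^ 2 -
              ‖(HardSphereCollisionRecord.ofConfig (Torus.geometry (Fin 3)) (hsDiameter σ N)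
                (Φ.flow t' z) t' p.1 p.2).preVel.1‖ ^ 2| / 2) := by
    intro z hz t' ht' p hp
    have hdist : Torus.euclidDist (Φ.flow t' z p.1).1 (Φ.flow t' z p.2).1 = hsDiameter σ N :=
      (mem_contactSet.1 (mem_contactPairs.1 hp).2).2
    have ht'I : t' ∈ Set.Icc 0 t := hIcc_t (Set.Ioc_subset_Icc_self ht'.2)
    have ht's : |t' - s| ≤ w := by
      rw [abs_of_nonneg (by linarith [ht'.2.1])]; linarith [ht'.2.2]
    have hLm' : ∀ (k : Fin 3) (x y : T3), |(u t' x k / θ t' x - u s x k / θ s x) - (u t' y k / θ t' y - u s y k / θ s y)| ≤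
        Cfz * w * Torus.euclidDist x y := by
      intro k x y
      have h3 := (HFZ t' ht'I s hs_t x 0).2.2.1 k y
      calc |u t' x k / θ t' x - u s x k / θ s x - (u t' y k / θ t' y - u s y k / θ s y)|
          = |(u t' x k / θ t' x - u t' y k / θ t' y) - (u s x k / θ s x - u s y k / θ s y)| := by ring_nf
        _ ≤ Cfz * |t' - s| * Torus.euclidDist x y := h3
        _ ≤ Cfz * w * Torus.euclidDist x y := by
            gcongr; exact ClampedCurrentsDockFreezeToolkit.euclidDist_nonneg x y
    have hLe' : ∀ x y : T3, |((θ t' x)⁻¹ - (θ s x)⁻¹) - ((θ t' y)⁻¹ - (θ s y)⁻¹)| ≤ Cfz * w * Torus.euclidDist x y := by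
      intro x y
      have h4 := (HFZ t' ht'I s hs_t x 0).2.2.2.1 y
      calc |(θ t' x)⁻¹ - (θ s x)⁻¹ - ((θ t' y)⁻¹ - (θ s y)⁻¹)|
          = |((θ t' x)⁻¹ - (θ t' y)⁻¹) - ((θ s x)⁻¹ - (θ s y)⁻¹)| := by ring_nf
        _ ≤ Cfz * |t' - s| * Torus.euclidDist x y := h4
        _ ≤ Cfz * w * Torus.euclidDist x y := by
            gcongr; exact ClampedCurrentsDockFreezeToolkit.euclidDist_nonneg x y
    have key := ClampedCurrentsDockHeart.abs_pairKernelGen_le (M := N + 1)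
      (f := fun k x => u t' x k / θ t' x - u s x k / θ s x) (g := fun x => (θ t' x)⁻¹ - (θ s x)⁻¹)
      (by positivity) hεN.le hLm' hLe'
      (HardSphereCollisionRecord.ofConfig (Torus.geometry (Fin 3)) (hsDiameter σ N) (Φ.flow t' z) t' p.1 p.2) hdist.le
    refine le_of_eq_of_le ?_ key
    congr 1
    simp only [hKt, hKsf, HardSphereCollisionRecord.ofConfig, Finset.sum_sub_distrib, sub_mul]
    ring
  exact ClampedCurrentsDockHeart.heart_pathwise Φ hσ hσ2 hw hCfz0 hDP hlohi hPc hloc hhic hfz1 hfz2 hz (hDgI z hz) (hKfz z hz)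

end Summit.AtomisticToContinuum.HydrodynamicLimit.Theorems.ClampedCurrentsDockHeart

end
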